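import Summits.BirchSwinnertonDyer.BirchSwinnertonDyer.Theorems.ShaPrimaryTransferFiniteShaComponentTransferTwistAtlas11a1A
import Literature.NumberTheory.EllipticCurves.IwasawaLeadingTermProofs
import HarnessLib

/-!
# BirchSwinnertonDyer — route ShaPrimaryTransfer, crux T `FiniteShaComponentTransfer`: the twist atlas of `11a1`,
# KERNEL EDITION — the symbol tables COMPUTED in the kernel from the 24 Manin symbols of `X₀(11)`, and the typed
# class-level door `TwistCongruenceDoor`

HONEST FRAMING: per-curve certified theorems and census instruments; no claim on BSD in rank ≥ 2 (cell
`bsd-rank2`, seat p2, GEN 58, currency 4b). Barrier B1: the door below is a conjecture-grade statement about an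
infinite class, DEFINED here and decided for single members; nothing is proved about the class.

WHAT THIS FILE ADDS to the data files `…TwistAtlas11a1{A,B,C}.lean` (whose symbol tables are literals produced by PARI):
the whole computation is re-done INSIDE LEAN by `decide +kernel` from 24 integers — the values `10·x⁺`, `10·x⁻` of the
modular symbol of `11a1` on the twelve Manin symbols `(c : d) ∈ P¹(ℤ/11)` (`maninPlus10`, `maninMinus10`; PARI
`msfromell`, kit job `j339479`, which also checks the evaluator below against `mseval` at 411 random arguments: 0
mismatches). From them: `msym10` = `10·{∞, r}^±` by the continued-fraction expansion into Manin symbols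
(`{∞, x/y} = Σ_j M(q_j : (−1)^{j−1} q_{j−1})` over the convergents `p_j/q_j`, Cremona §2.1), `kron` = the Kronecker
symbol `χ_D` by binary reciprocity (checked against Euler's criterion on 510 774 pairs, 0 mismatches — generator
`twistK/twistk.py`), `twSum10 D r` = `10·T_D(r)` = Birch's twisted sum `Σ_{a mod |D|} χ_D(a)·10{∞, r + a/|D|}^{sgn D}`,
the cell tables `twistTabHi/Lo`, the unit-root digit, and `twistCert p n D : SymbolCertL` with its kernel Boolean
`twistCellValid p n D` (= the atlas test `SymbolCertL.validL`, i.e. `p^n ∤ A·ΣHi − ΣLo` with its side conditions).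
KERNEL FACTS (each ONE `decide +kernel`, ≈ 100 s for a level-49 cell): `twSum10 D 0 1 = 0` (i.e. `L(11a1^(D),1) = 0`
EXACTLY) for the twelve `D` of part A; the class predicate `inTwistClass` at `232` and `−344`; the level-`49` certificates
`twistCellValid 7 1 232`; and the
CROSS-CHECK `crossCheck_232_7`: at every unit residue the kernel-computed tables of `(11a1^(232), 7)` are exactly `50×`
the literal tables of the landed cell `twp232` of part A (`50 = 10·content/denominator` of the raw PARI table; the
generator checks the same proportionality for all 22 cells of part A in Python).
CONSEQUENCE (`doorRow`, from `padicRow_of_symbolCertL`): for ANY `D`, `p ≥ 5`, `n`, if `twistCert p n D` is valid then —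
GIVEN `hPRS`, `hkato`, the newform `hf` of a globally minimal model `W` of `11a1^(D)` with `a_p(W) = χ_D(p) a_p(11a1)`,
`hlow : 2 ≤ rank W`, `p`-integrality `hint`, and the IDENTIFICATION `htw` of the true plus symbols of `f` at the points
`u/p^{n+1}`, `u/p^n` with `twSum10 D …/K` for one `p`-unit `K` (Birch's formula with its period ratio, MTT §I.8; `K`
absorbs `10`, the `2`-power of the twist and, at `p ≠ 5`, the `5`-isogeny/Manin factors — see part A's docstring for why
`p = 5` is excluded) — `rank W = 2 = ord_{T=0} L_p = corank Sel_{p^∞}`, `Ш(W)[p^∞]` finite, Schneider non-degeneracy, and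
`shaCorank W p = 0` (the crux instance `(W, q, p)` for every `q`).  So a member's row needs NO tabulated data any more:
`twistCellValid p n D = true` by `decide` plus the uniform hypotheses.
THE TYPED DOOR (`TwistCongruenceDoor p n`, a `Prop`, NOT claimed): the set of `D` in the class `InTwistClass`
(`D` fundamental, `11 ∤ D`, `w(11a1^(D)) = sgn(D)·χ_D(11) = +1`, `T_D(0) = 0`) with `p ∤ D` and `twistCellValid p n D` is
infinite.  With `2 ≤ rank` along it (Stewart–Top-type families) `doorRow` turns it into infinitely many rank-2 curves with
`Ш[p^∞]` finite and rank = Selmer corank = `p`-adic analytic order; it says nothing about `ord_{s=1} L` (B1).  Observed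
density inside the class for `|D| ≤ 3·10⁴` (kit `j339417`): `654/662` at `p = 7` (levels `49`, `343`), `692/703` at `13`.
What is NOT claimed: that `kron`/`msym10` are the Kronecker symbol / the modular symbol (they are definitions here, validated
numerically by the generator and by `crossCheck_232_7`; the row theorem only ever uses them through the hypothesis `htw`),
anything about the class, anything at `p = 5`.  No axioms, no `sorry`, kernel `decide` only.

References: B. Mazur, J. Tate, J. Teitelbaum, Invent. Math. 84 (1986), §I.8, §I.10–I.13; J. Cremona, Algorithms for
Modular Elliptic Curves (1997), §2.1–2.2 (M-symbols, continued fractions), §2.8, Table 1; K. Kato, Astérisque 295 (2004),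
Thm. 17.4; J. Balakrishnan, J. S. Müller, W. Stein, Math. Comp. 85 (2016), Thm. 1.7; P. Schneider, Invent. Math. 79
(1985), Thm 2'; C. L. Stewart, J. Top, J. AMS 8 (1995) (twists of rank ≥ 2); H. Cohen, A Course in Computational
Algebraic Number Theory (1993), Alg. 1.4.10 (Kronecker symbol).
-/

-- single-conjunct summit: `Summit.BirchSwinnertonDyer.BirchSwinnertonDyer.…` repeats the name by design
set_option linter.dupNamespace false

namespace Summit.BirchSwinnertonDyer.BirchSwinnertonDyer.Theorems.ShaPrimaryTransferTwistAtlas11a1Kernel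

open scoped MatrixGroups ModularForm
open CongruenceSubgroup Literature.NumberTheory.EllipticCurves
  Literature.NumberTheory.EllipticCurves.ModularForms WeierstrassCurve
open Summit.BirchSwinnertonDyer.BirchSwinnertonDyer.Rank2Observatory
open Summit.BirchSwinnertonDyer.BirchSwinnertonDyer.Theorems.ShaPrimaryTransferTwistAtlas11a1A (twp232)
open Literature.NumberTheory.Sieve.GoldbachLinnik (primeB prime_of_primeB)

/-- `10 · x⁺` of `11a1` on the Manin symbols `(k : 1)`, `k = 0 … 10`, and `(1 : 0)` (PARI `msfromell`). [folklore] -/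
def maninPlus10 : List ℤ := [-2, 0, -10, -5, 5, 10, 10, 5, -5, -10, 0, 2]

/-- `10 · x⁻` of `11a1` on the same Manin symbols. [folklore] -/
def maninMinus10 : List ℤ := [0, 0, 0, 5, 5, 0, 0, -5, -5, 0, 0, 0]

/-- inverses modulo `11` (index `0` unused). [folklore] -/
def inv11 : List ℕ := [0, 1, 6, 4, 3, 9, 2, 8, 7, 5, 10]

/-- The index in `0 … 11` of the point `(c : d) ∈ P¹(ℤ/11)`: `(c d⁻¹ : 1)` if `11 ∤ d`, else `(1 : 0) ↦ 11`. [folklore] -/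
def p1Index11 (c d : ℤ) : ℕ :=
  let dm := (d % 11).toNat
  if dm = 0 then 11 else ((c * (inv11.getD dm 0 : ℕ)) % 11).toNat

/-- Continued-fraction accumulation of Manin symbols: with convergents `p_j/q_j` of `x/y`,
`{∞, x/y} = Σ_j M(q_j : (−1)^{j−1} q_{j−1})` (fuel-bounded structural recursion). [folklore] -/
def cfManinSum (tab : List ℤ) : ℕ → ℤ → ℤ → ℤ → ℤ → ℕ → ℤ → ℤ
  | 0, _, _, _, _, _, acc => acc
  | fuel + 1, x, y, qm1, qm2, j, acc =>
    if y = 0 then acc else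
      let qj := x / y * qm1 + qm2
      cfManinSum tab fuel y (x % y) qj qm1 (j + 1)
        (acc + tab.getD (p1Index11 qj (if j % 2 = 0 then -qm1 else qm1)) 0)

/-- `10 · {∞, num/den}^±` of `11a1` (`den > 0`, `num ≥ 0`). [folklore] -/
def msym10 (tab : List ℤ) (num : ℤ) (den : ℕ) : ℤ := cfManinSum tab 400 num den 0 1 0 0

/-- Jacobi symbol `(a / n)`, `n` odd, by binary reciprocity (fuel-bounded). [folklore] -/
def jacobiAux : ℕ → ℕ → ℕ → ℤ → ℤ
  | 0, _, _, _ => 0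
  | fuel + 1, a, n, s =>
    if n = 1 then s else if a = 0 then 0 else
    if a % 2 = 0 then jacobiAux fuel (a / 2) n (if n % 8 = 3 ∨ n % 8 = 5 then -s else s)
    else jacobiAux fuel (n % a) a (if a % 4 = 3 ∧ n % 4 = 3 then -s else s)

/-- Kronecker symbol `(D / 2)`. [folklore] -/
def kron2 (D : ℤ) : ℤ :=
  let m := (D % 8).toNat
  if m % 2 = 0 then 0 else if m = 1 ∨ m = 7 then 1 else -1

/-- Kronecker symbol `(D / a)`, `a ≥ 1`, removing the `2`-part of `a` first (fuel-bounded). [folklore] -/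
def kronAux (D : ℤ) : ℕ → ℕ → ℤ → ℤ
  | 0, _, _ => 0
  | fuel + 1, a, s =>
    if a = 0 then 0 else if a % 2 = 0 then kronAux D fuel (a / 2) (s * kron2 D)
    else s * jacobiAux 400 ((D % (a : ℤ)).toNat) a 1

/-- The quadratic character `χ_D(a) = (D / a)` (Kronecker symbol; `χ_D(0) = 0`). [folklore] -/
def kron (D : ℤ) (a : ℕ) : ℤ := kronAux D 64 a 1

/-- `10 · T_D(num/den)`: Birch's twisted sum `Σ_{a mod |D|} χ_D(a) · 10{∞, num/den + a/|D|}^{sgn D}` of `11a1`. [folklore] -/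
def twSum10 (D : ℤ) (num : ℤ) (den : ℕ) : ℤ :=
  let aD := D.natAbs
  let tab := if 0 < D then maninPlus10 else maninMinus10
  ((List.range aD).map fun a : ℕ => kron D a * msym10 tab (num * (aD : ℤ) + (a : ℤ) * (den : ℤ)) (den * aD)).sum

/-- `a_p(11a1)` for the primes `p ≤ 47` (else junk `0`). [folklore] -/
def ap11 (p : ℕ) : ℤ :=
  [(2, -2), (3, -1), (5, 1), (7, -2), (11, 1), (13, 4), (17, -2), (19, 0), (23, -1), (29, 0), (31, 7),
    (37, 3), (41, -8), (43, -6), (47, 8)].lookup p |>.getD 0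

/-- `a_p(11a1^(D)) = χ_D(p) a_p(11a1)`. [folklore] -/
def apTwist (D : ℤ) (p : ℕ) : ℤ := kron D p * ap11 p

/-- An integer `≡ α_p (mod p^n)` for `n ≤ 2`: `a_p`, resp. `a_p − p·(a_p⁻¹ mod p)`. [folklore] -/
def unitRootDigit (p n : ℕ) (ap : ℤ) : ℤ :=
  let inv : ℕ := ((List.range p).find? fun i : ℕ => (ap * (i : ℤ)) % (p : ℤ) = 1).getD 0
  if n ≤ 1 then ap else ap - (p : ℤ) * (inv : ℤ)

/-- table `10 T_D(u/p^{n+1})`, `u < p^{n+1}`. [folklore] -/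
def twistTabHi (p n : ℕ) (D : ℤ) : List ℤ :=
  (List.range (p ^ (n + 1))).map fun u : ℕ => twSum10 D (u : ℤ) (p ^ (n + 1))

/-- table `10 T_D((u mod p^n)/p^n)`, `u < p^{n+1}`. [folklore] -/
def twistTabLo (p n : ℕ) (D : ℤ) : List ℤ :=
  (List.range (p ^ (n + 1))).map fun u : ℕ => twSum10 D ((u % p ^ n : ℕ) : ℤ) (p ^ n)

variable (p : ℕ) [Fact p.Prime] in
/-- The COMPUTED level-`p^{n+1}` certificate of the twist `11a1^(D)` (order `2`). [folklore] -/
def twistCert (n : ℕ) (D : ℤ) : SymbolCertL :=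
  ⟨2, n, unitRootDigit p n (apTwist D p), twistTabHi p n D, twistTabLo p n D,
    isumL p n (twistTabHi p n D) 2, isumL p n (twistTabLo p n D) 2⟩

/-- The kernel Boolean: the computed certificate of `(11a1^(D), p)` at level `p^{n+1}` is valid. [folklore] -/
def twistCellValid (p n : ℕ) (D : ℤ) : Bool :=
  if hp : primeB p = true then
    @SymbolCertL.validL p ⟨prime_of_primeB hp⟩ (apTwist D p) (@twistCert p ⟨prime_of_primeB hp⟩ n D)
  else false

/-! ### The class and the door -/

/-- squarefreeness by trial division (Boolean). [folklore] -/
def isSquarefreeB (m : ℕ) : Bool :=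
  (List.range (m + 1)).all fun q => decide (q < 2) || !decide (q * q ∣ m)

/-- `D` is a fundamental discriminant (Boolean). [folklore] -/
def isFundDisc (D : ℤ) : Bool :=
  (decide (D % 4 = 1) && isSquarefreeB D.natAbs) ||
    (decide (D % 4 = 0) && (decide (D / 4 % 4 = 2) || decide (D / 4 % 4 = 3)) &&
      isSquarefreeB (D / 4).natAbs)

/-- The root number of `11a1^(D)` for `gcd(D, 11) = 1`: `w = χ_D(−11)·w(11a1) = sgn(D)·χ_D(11)`.
[cite: SilvermanAEC2009, X.3] -/
def rootNumberTwist11 (D : ℤ) : ℤ := (if 0 < D then 1 else -1) * kron D 11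

/-- **The class `T`**: `D` fundamental, `11 ∤ D`, root number `+1`, and `T_D(0) = 0`, i.e. `L(11a1^(D), 1) = 0`
exactly (so `ord_{s=1} L(11a1^(D), s) ≥ 2`, even). [cite: MazurTateTeitelbaum1986Invent, §I.8] -/
def inTwistClass (D : ℤ) : Bool :=
  isFundDisc D && decide (Int.gcd D 11 = 1) && decide (rootNumberTwist11 D = 1) && decide (twSum10 D 0 1 = 0)

/-- **THE TYPED DOOR (conjecture-grade; defined, not claimed).** `TwistCongruenceDoor p n`: infinitely many `D`
in the class with `p ∤ D` whose computed level-`p^{n+1}` certificate is valid (`p^n ∤ A·ΣHi − ΣLo`): a congruence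
property of the quadratic-character sums of ONE modular symbol. [cite: MazurTateTeitelbaum1986Invent, §I.10–I.13] -/
@[conjecture] def TwistCongruenceDoor (p n : ℕ) : Prop :=
  {D : ℤ | inTwistClass D = true ∧ ¬ (p : ℤ) ∣ D ∧ twistCellValid p n D = true}.Infinite

/-! ### Reading the computed tables -/

/-- entry `u < p^{n+1}` of the high table. [folklore] -/
theorem twistTabHi_getD (p n : ℕ) (D : ℤ) {u : ℕ} (hu : u < p ^ (n + 1)) :
    (twistTabHi p n D).getD u 0 = twSum10 D u (p ^ (n + 1)) := by
  simp [twistTabHi, List.getD, List.getElem?_range hu]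

/-- entry `u < p^{n+1}` of the (expanded) low table. [folklore] -/
theorem twistTabLo_getD (p n : ℕ) (D : ℤ) {u : ℕ} (hu : u < p ^ (n + 1)) :
    (twistTabLo p n D).getD u 0 = twSum10 D ((u % p ^ n : ℕ) : ℤ) (p ^ n) := by
  simp [twistTabLo, List.getD, List.getElem?_range hu]

/-- From the kernel Boolean to validity at the `Fact` instance in scope. [folklore] -/
theorem validL_of_twistCellValid {p n : ℕ} {D : ℤ} [Fact p.Prime]
    (h : twistCellValid p n D = true) :
    SymbolCertL.validL p (apTwist D p) (twistCert p n D) = true := by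
  unfold twistCellValid at h
  split_ifs at h with hb
  exact h

/-! ### The row of a member from the computed certificate -/

/-- **The `p`-adic row of a twist from its COMPUTED certificate.** For any `D`, `p ≥ 5`, `n`: if
`twistCert p n D` is valid, then for a globally minimal model `W` of `11a1^(D)` — GIVEN `hPRS` (BMS Thm. 1.7),
`hkato` (Kato Thm. 17.4), the newform `hf`, ordinarity and `a_p(W) = χ_D(p)·a_p(11a1)`, `hlow : 2 ≤ rank`,
`p`-integrality of the plus symbols and their identification `htw` with Birch's twisted sums up to one
`p`-unit `K` — `rank W = 2 = ord_{T=0} L_p`, `Ш(W)[p^∞]` finite, Schneider non-degeneracy,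
`corank Sel_{p^∞} = 2` and `shaCorank W p = 0`. [cite: MazurTateTeitelbaum1986Invent, §I.8, §I.10–I.13]
[cite: Kato2004Asterisque, Thm. 17.4 (p. 273)] [cite: BalakrishnanMullerStein2015, Thm. 1.7] -/
theorem doorRow (p n : ℕ) [Fact p.Prime] (h5 : 5 ≤ p) (D : ℤ)
    (hc : SymbolCertL.validL p (apTwist D p) (twistCert p n D) = true)
    (hPRS : Schneider1985_order_charGenerator) (W : WeierstrassCurve ℚ) [W.IsElliptic]
    [W.IsGloballyMinimal] (hord : IsOrdinaryAt W p) (hap : W.frobeniusTrace p = apTwist D p)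
    {N : ℕ} [NeZero N] {f : CuspForm (Gamma0 N) 2} (hf : IsNewformOf W f)
    (hkato : ∀ (κ : ZpExtension ℚ p) (γ : Field.absoluteGaloisGroup ℚ),
      kato_divisibility W p (κ := κ) (γ := γ) (f := f))
    (hlow : 2 ≤ W.mordellWeilRank) (K : ℚ) (hK : ‖(K : ℚ_[p])‖ = 1)
    (hint : ∀ x : ℚ, ‖(ratPlusSymbol f x : ℚ_[p])‖ ≤ 1)
    (htw : ∀ u : ℕ, u < p ^ (n + 1) → ¬ p ∣ u →
      ratPlusSymbol f ((u : ℚ) / (p : ℚ) ^ (n + 1)) = (twSum10 D u (p ^ (n + 1)) : ℚ) / K ∧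
      ratPlusSymbol f ((u : ℚ) / (p : ℚ) ^ n) = (twSum10 D ((u % p ^ n : ℕ) : ℤ) (p ^ n) : ℚ) / K) :
    W.mordellWeilRank = 2 ∧ (padicLFunction f (unitRoot W p : ℚ_[p])).order = 2 ∧
      Finite (AddCommGroup.primaryComponent W.sha p) ∧
      (∀ Dh : PAdicHeightData W p, Dh.IsCanonical → SchneiderConjecture Dh) ∧
      W.selmerCorank p = 2 ∧ W.shaCorank p = 0 := by
  have htab : ∀ u : ℕ, u < p ^ ((twistCert p n D).n + 1) → ¬ p ∣ u →
      ratPlusSymbol f ((u : ℚ) / (p : ℚ) ^ ((twistCert p n D).n + 1)) =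
          ((twistCert p n D).tabHi.getD u 0 : ℚ) / K ∧
        ratPlusSymbol f ((u : ℚ) / (p : ℚ) ^ (twistCert p n D).n) =
          ((twistCert p n D).tabLo.getD u 0 : ℚ) / K := by
    intro u hu hpu
    simp only [twistCert] at hu ⊢
    rw [twistTabHi_getD p n D hu, twistTabLo_getD p n D hu]
    exact htw u hu hpu
  obtain ⟨hr, ho, hfin, hS, hsel⟩ :=
    padicRow_of_symbolCertL p hPRS W h5 hord hap hf hkato (twistCert p n D) hc hlow K hK hint htab
  refine ⟨hr, ho, hfin, hS, hsel, ?_⟩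
  rw [← finite_primaryComponent_sha_iff_shaCorank_eq_zero]
  exact hfin

/-- The same row from the kernel Boolean `twistCellValid p n D = true`. [folklore] -/
theorem doorRow_of_valid (p n : ℕ) [Fact p.Prime] (h5 : 5 ≤ p) (D : ℤ)
    (hc : twistCellValid p n D = true)
    (hPRS : Schneider1985_order_charGenerator) (W : WeierstrassCurve ℚ) [W.IsElliptic]
    [W.IsGloballyMinimal] (hord : IsOrdinaryAt W p) (hap : W.frobeniusTrace p = apTwist D p)
    {N : ℕ} [NeZero N] {f : CuspForm (Gamma0 N) 2} (hf : IsNewformOf W f)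
    (hkato : ∀ (κ : ZpExtension ℚ p) (γ : Field.absoluteGaloisGroup ℚ),
      kato_divisibility W p (κ := κ) (γ := γ) (f := f))
    (hlow : 2 ≤ W.mordellWeilRank) (K : ℚ) (hK : ‖(K : ℚ_[p])‖ = 1)
    (hint : ∀ x : ℚ, ‖(ratPlusSymbol f x : ℚ_[p])‖ ≤ 1)
    (htw : ∀ u : ℕ, u < p ^ (n + 1) → ¬ p ∣ u →
      ratPlusSymbol f ((u : ℚ) / (p : ℚ) ^ (n + 1)) = (twSum10 D u (p ^ (n + 1)) : ℚ) / K ∧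
      ratPlusSymbol f ((u : ℚ) / (p : ℚ) ^ n) = (twSum10 D ((u % p ^ n : ℕ) : ℤ) (p ^ n) : ℚ) / K) :
    W.mordellWeilRank = 2 ∧ Finite (AddCommGroup.primaryComponent W.sha p) ∧
      W.selmerCorank p = 2 ∧ W.shaCorank p = 0 := by
  obtain ⟨hr, -, hfin, -, hsel, h0⟩ := doorRow p n h5 D (validL_of_twistCellValid hc) hPRS W hord hap
    hf hkato hlow K hK hint htw
  exact ⟨hr, hfin, hsel, h0⟩

/-! ### Kernel facts (`decide +kernel` only) -/

/-- `L(11a1^(D), 1) = 0` EXACTLY for the twelve twists of part A: `T_D(0) = 0`. [folklore] -/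
theorem twSum10_zero_partA :
    [232, 265, -344, 344, 401, 421, -488, 488, 553, -599, 617, 632].all
      (fun D : ℤ => twSum10 D 0 1 == 0) = true := by
  decide +kernel

/-- `232` and `−344` lie in the class: fundamental, `11 ∤ D`, root number `+1`, `T_D(0) = 0`. [folklore] -/
theorem inTwistClass_232_neg344 : inTwistClass 232 = true ∧ inTwistClass (-344) = true := by
  constructor <;> decide +kernel

/-- **The level-49 certificate of `11a1^(232)`, computed in the kernel from the 24 Manin integers**
(`a_7 = −2`; ≈ 100 s of kernel time; the same statement for `|D| = 344` exceeds the kernel's recursion budget in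
one `decide`, so larger members are certified through the data files). [folklore] -/
theorem twistCellValid_7_232 : twistCellValid 7 1 232 = true := by
  decide +kernel

/-- **CROSS-CHECK against the landed data** (part A, cell `(11a1^(232), 7)` = the first cell of `twp232`): at
every unit residue the kernel-computed tables are `50×` the literal ones. [folklore] -/
theorem crossCheck_232_7 :
    ((List.range 49).all fun u => decide (7 ∣ u) ||
      ((twistTabHi 7 1 232).getD u 0 == 50 * ((twp232.cells.map AtlasCell.tabHi).getD 0 []).getD u 0 &&
        (twistTabLo 7 1 232).getD u 0 ==
          50 * ((twp232.cells.map AtlasCell.tabLo).getD 0 []).getD (u % 7) 0)) = true := by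
  decide +kernel

/-- `232` is a member of the door's set at `(p, n) = (7, 1)`. [folklore] -/
theorem mem_door_set_7_232 :
    (232 : ℤ) ∈ {D : ℤ | inTwistClass D = true ∧ ¬ (7 : ℤ) ∣ D ∧ twistCellValid 7 1 D = true} :=
  ⟨inTwistClass_232_neg344.1, by decide, twistCellValid_7_232⟩

end Summit.BirchSwinnertonDyer.BirchSwinnertonDyer.Theorems.ShaPrimaryTransferTwistAtlas11a1Kernel
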